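import Summits.HodgeConjecture.CorCM.DihedralSexticPairCurveTransfer
import Summits.HodgeConjecture.CorCM.DihedralSexticPairHodgeOfMarkman
import Summits.HodgeConjecture.CorCM.CMWeightPullbackSubproduct
import Summits.HodgeConjecture.CorCM.WeilFourfoldOfMarkmanPlane
import HarnessLib

/-!
# COR-CM — the generating weight lines of `E × B₀ × B₁` are algebraic modulo Markman: the pair weights (from
# `B₀ × B₁`) and the `k`-Weil weights of the fourfolds `Bₘ × E`

Cell `pub-hodgecm2` (COR-CM), seat b30 gen 14 (2026-08-21); COUNT-NEUTRAL; theorems only, no definition, no named fact,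
no `sorry`.  Discharges the two generator hypotheses of
`DihedralSexticPairCurve.hodgeConjectureFor_biproduct_curveSlots_of_generators` (`CorCM/DihedralSexticPairCurveTransfer.lean`):

* §1 `weilClassesOf_biproduct_le_algebraicClasses_of_biprod` — transport of the algebraicity of a Weil plane from the binary
  biproduct `A 0 ⊞ A 1` to `⨁_{j<2} A_j` (companion of `PairWeights.weilClassesOf_biproduct_le_algebraicClasses_of_prod`)
  [cite: vanGeemen1994HodgeAV, 3.6–3.7];
* §2 `weightClassesAlg_le_algebraicClasses_of_image_eq_pair6` — a weight of `E × B₀ × B₁` whose model image is a pair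
  weight `pair6 b` lives on the slots of `B₀ × B₁`; its line is the pull-back (`CMWeights.weightClassesAlg_map_le_algebraicClasses`,
  `e = Fin.succ`) of a line of the Weil plane of `(B₀ × B₁, ι₀(iδ) ⊕ ι₁(īδ))`, algebraic modulo Markman
  (`DihedralSexticPair.weilClassesOf_biproduct_le_algebraicClasses_of_frame_of_markman`) [cite: Markman2025SurveySecant, Thm. 1.2];
* §3 `weightClassesAlg_le_algebraicClasses_of_image_eq_weil4` — a weight with image `weil4 m b` lives on the slots of
  `Bₘ × E`; its line is the pull-back (`e = (m+1, 0)`) of the `±i√d`-eigenline of `(Bₘ ⊞ E, ι_m(iδ) ⊞ ι_E(δ))`, a Weil-type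
  FOURFOLD (`k`-signature `(1,2) + (1,0) = (2,2)`), algebraic modulo Markman by the tree's
  `WeilFourfold.weilClassesOf_le_algebraicClasses_cmThreefold_biprod_cmCurve` [cite: Markman2025SurveySecant, Thm. 1.2]
  [cite: Deligne1982HodgeCycles, §5 (c)].

## References
* [Markman2025SurveySecant] E. Markman, arXiv:2509.23403, Thm. 1.2.  [vanGeemen1994HodgeAV] B. van Geemen, LNM 1594,
  3.6–3.7, 4.9.  [Deligne1982HodgeCycles] LNM 900, §5 (c).  [Milne2020HodgeClassesAV] 1.2 (a).
-/

noncomputable section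

open CategoryTheory CategoryTheory.Limits NumberField

namespace Summit.HodgeConjecture.CorCM.DihedralSexticPairCurve

open Literature.AlgebraicGeometry Literature.AlgebraicGeometry.Motives Literature.AlgebraicGeometry.HodgeTheory
open Literature.AlgebraicGeometry.ComplexMultiplication (IsCMTypeRealisation)
open Literature.AlgebraicGeometry.Pohlmann1968
open Literature.AlgebraicTopology.SingularHomology
open Literature.NumberTheory.ComplexMultiplication
open Summit.HodgeConjecture.CorCM.Census.DihedralSexticPair (weilPlus weilMinus weil_structure)
open Summit.HodgeConjecture.CorCM.Census.DihedralSexticPairCurve (Pt' weil4 pair6 mem_weil4_iff mem_pair6_iff)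
open Summit.HodgeConjecture.CorCM.DihedralSexticPair (apply_weilFamily_eq card_filter_equiv_mem
  weilClassesOf_biproduct_le_algebraicClasses_of_frame_of_markman comp_eq_conjugate_of_sign_false)
open Summit.HodgeConjecture.CorCM.PairWeights
open Summit.HodgeConjecture.CorCM.CMWeights (weightClassesAlg_map_le_algebraicClasses sigma_map_injective)

open scoped Classical

/-! ## §1 `A 0 ⊞ A 1` versus `⨁_{j<2} A_j` -/

section Biprod

variable {A : Fin 2 → AbelianVariety ℂ}

/-- `(fst, snd) : A₀ ⊞ A₁ ⟶ ⨁_{j<2} A_j` composed with `π₀` is `biprod.fst`. [folklore] -/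
theorem biproduct_lift_biprod_π_zero :
    biproduct.lift (Fin.cons (biprod.fst : A 0 ⊞ A 1 ⟶ A 0)
        (Fin.cons (biprod.snd : A 0 ⊞ A 1 ⟶ A 1) finZeroElim) : ∀ j, (A 0 ⊞ A 1) ⟶ A j) ≫
      biproduct.π A 0 = biprod.fst := by
  rw [biproduct.lift_π]; rfl

/-- The second component. [folklore] -/
theorem biproduct_lift_biprod_π_one :
    biproduct.lift (Fin.cons (biprod.fst : A 0 ⊞ A 1 ⟶ A 0)
        (Fin.cons (biprod.snd : A 0 ⊞ A 1 ⟶ A 1) finZeroElim) : ∀ j, (A 0 ⊞ A 1) ⟶ A j) ≫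
      biproduct.π A 1 = biprod.snd := by
  rw [biproduct.lift_π]; rfl

/-- `(π₀, π₁) ≫ (fst, snd) = 𝟙`. [folklore] -/
theorem biprod_lift_π_comp_biproduct_lift :
    biprod.lift (biproduct.π A 0) (biproduct.π A 1) ≫
      biproduct.lift (Fin.cons (biprod.fst : A 0 ⊞ A 1 ⟶ A 0)
        (Fin.cons (biprod.snd : A 0 ⊞ A 1 ⟶ A 1) finZeroElim) : ∀ j, (A 0 ⊞ A 1) ⟶ A j) = 𝟙 (⨁ A) := by
  refine biproduct.hom_ext _ _ fun j => ?_
  rw [Category.assoc, Category.id_comp]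
  refine Fin.cases ?_ (fun i => Fin.cases ?_ (fun l => l.elim0) i) j
  · rw [biproduct_lift_biprod_π_zero, biprod.lift_fst]
  · change _ ≫ _ ≫ biproduct.π A 1 = biproduct.π A 1
    rw [biproduct_lift_biprod_π_one, biprod.lift_snd]

/-- Equivariance of `(fst, snd)` for `f₀ ⊞ f₁` and `⊕_j f_j`. [folklore] -/
theorem biproduct_lift_comp_map_biprod (f : ∀ j, A j ⟶ A j) :
    biproduct.lift (Fin.cons (biprod.fst : A 0 ⊞ A 1 ⟶ A 0)
        (Fin.cons (biprod.snd : A 0 ⊞ A 1 ⟶ A 1) finZeroElim) : ∀ j, (A 0 ⊞ A 1) ⟶ A j) ≫ biproduct.map f =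
    biprod.map (f 0) (f 1) ≫ biproduct.lift (Fin.cons (biprod.fst : A 0 ⊞ A 1 ⟶ A 0)
        (Fin.cons (biprod.snd : A 0 ⊞ A 1 ⟶ A 1) finZeroElim) : ∀ j, (A 0 ⊞ A 1) ⟶ A j) := by
  refine biproduct.hom_ext _ _ fun j => ?_
  rw [Category.assoc, biproduct.map_π, Category.assoc]
  refine Fin.cases ?_ (fun i => Fin.cases ?_ (fun l => l.elim0) i) j
  · rw [← Category.assoc, biproduct_lift_biprod_π_zero, biprod.map_fst]
  · change _ ≫ biproduct.π A 1 ≫ f 1 = _ ≫ _ ≫ biproduct.π A 1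
    rw [← Category.assoc, biproduct_lift_biprod_π_one, biprod.map_snd]

/-- **The Weil plane of `(⨁_{j<2} A_j, ⊕_j f_j)` is algebraic if that of `(A₀ ⊞ A₁, f₀ ⊞ f₁)` is.**
[cite: vanGeemen1994HodgeAV, 3.6–3.7 and proof of Lemma 5.2] -/
theorem weilClassesOf_biproduct_le_algebraicClasses_of_biprod (f : ∀ j, A j ⟶ A j) {n d : ℕ}
    (h : weilClassesOf (A 0 ⊞ A 1) (biprod.map (f 0) (f 1)) n d ≤ algebraicClasses (A 0 ⊞ A 1).X n) :
    weilClassesOf (⨁ A) (biproduct.map f) n d ≤ algebraicClasses (⨁ A).X n := by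
  intro c hc
  set g : (A 0 ⊞ A 1) ⟶ ⨁ A := biproduct.lift (Fin.cons (biprod.fst : A 0 ⊞ A 1 ⟶ A 0)
    (Fin.cons (biprod.snd : A 0 ⊞ A 1 ⟶ A 1) finZeroElim) : ∀ j, (A 0 ⊞ A 1) ⟶ A j) with hg_def
  have hg := map_mem_weilClassesOf_of_comm (n := n) (d := d) (biproduct_lift_comp_map_biprod f) hc
  have halg := h hg
  have h2 := map_mem_algebraicClasses_of_abelianVariety
    (Motives.AbelianVariety.isSmoothProjective_holds (A := ⨁ A)) (A 0 ⊞ A 1)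
    (biprod.lift (biproduct.π A 0) (biproduct.π A 1)).hom.hom.hom halg
  have key : complexBetti.map (biprod.lift (biproduct.π A 0) (biproduct.π A 1)).hom.hom.hom (2 * n)
      (singularCohomology.map ℂ ℂ (Motives.AlgPoints.mapContinuous (L := ℂ) g.hom.hom.hom) (2 * n) c) = c := by
    change singularCohomology.map ℂ ℂ (Motives.AlgPoints.mapContinuous (L := ℂ)
      (biprod.lift (biproduct.π A 0) (biproduct.π A 1)).hom.hom.hom) (2 * n) _ = c
    rw [abelianVarietyHom_map_map_apply, hg_def, biprod_lift_π_comp_biproduct_lift]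
    exact abelianVariety_map_id_apply c
  rw [key] at h2
  exact h2

end Biprod

/-! ## §2 The pair weights -/

section Generators

variable {I : Type} {Kf : I → Type} [∀ i, Field (Kf i)] [∀ i, NumberField (Kf i)]
  {i₀ i₁ : I} {e : (Kf i₁ →+* ℂ) ≃ ZMod 3 × Bool} {τ : Kf i₀ →+* ℂ} {i : Kf i₀ →+* Kf i₁}
  {A₃ : Fin 3 → AbelianVariety ℂ} {Φ₃ : ∀ j : Fin 3, CMType (Kf (curveSlots i₀ i₁ j))}
  {ι₃ : ∀ j, 𝓞 (Kf (curveSlots i₀ i₁ j)) →+* End (A₃ j)}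
  {θ₃ : ∀ j, Kf (curveSlots i₀ i₁ j) →+* Module.End ℂ (complexBetti (A₃ j).X 1)}

/-- A weight is the image of its restriction to an injective sub-family of slots containing all its slots.
[folklore] -/
theorem exists_map_sigma_eq {m : ℕ} (eₘ : Fin m → Fin 3) (heₘ : Function.Injective eₘ)
    (T : Finset ((j : Fin 3) × (Kf (curveSlots i₀ i₁ j) →+* ℂ))) (hT : ∀ x ∈ T, ∃ j, x.1 = eₘ j) :
    ∃ S'' : Finset ((j : Fin m) × (Kf (curveSlots i₀ i₁ (eₘ j)) →+* ℂ)),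
      S''.map ⟨_, sigma_map_injective (K := fun j => Kf (curveSlots i₀ i₁ j)) eₘ heₘ⟩ = T ∧
        ∀ y, y ∈ S'' ↔ (⟨eₘ y.1, y.2⟩ : (j : Fin 3) × (Kf (curveSlots i₀ i₁ j) →+* ℂ)) ∈ T := by
  refine ⟨Finset.univ.filter fun y => (⟨eₘ y.1, y.2⟩ : (j : Fin 3) × (Kf (curveSlots i₀ i₁ j) →+* ℂ)) ∈ T,
    ?_, fun y => by simp⟩
  ext x
  rw [Finset.mem_map]
  constructor
  · rintro ⟨y, hy, rfl⟩
    exact (Finset.mem_filter.1 hy).2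
  · intro hx
    obtain ⟨j, hj⟩ := hT x hx
    obtain ⟨j', s⟩ := x
    dsimp only at hj
    subst hj
    exact ⟨⟨j, s⟩, Finset.mem_filter.2 ⟨Finset.mem_univ _, hx⟩, rfl⟩

/-- **The pair-weight lines are algebraic modulo Markman**: a weight `T` of `E × B₀ × B₁` with model image `pair6 b` is
the weight `W₊` or `W₋` of the slots of `B₀ × B₁`, whose line is a line of the Weil plane of
`(B₀ × B₁, ι₀(iδ) ⊕ ι₁(īδ))`, pulled back. [cite: Markman2025SurveySecant, Thm. 1.2] [cite: Deligne1982HodgeCycles, §5 (c)] -/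
theorem weightClassesAlg_le_algebraicClasses_of_image_eq_pair6 [∀ i, IsCMField (Kf i)]
    (hW4 : Markman2025_weilClasses_algebraic_abelianFourfold)
    (h6 : Module.finrank ℚ (Kf i₁) = 6) (h2 : Module.finrank ℚ (Kf i₀) = 2)
    {δ : 𝓞 (Kf i₀)} {d : ℕ} (hd : 0 < d) (hδ : ((δ : Kf i₀)) ^ 2 = -(d : Kf i₀))
    (hτ : τ (δ : Kf i₀) = Complex.I * (Real.sqrt d : ℂ))
    (hA : ∀ j, IsCMTypeRealisation (Φ₃ j) (A₃ j) (ι₃ j) (θ₃ j))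
    (he_sign : ∀ s : Kf i₁ →+* ℂ, s.comp i = τ ↔ (e s).2 = true)
    (hΦ : ∀ (m : Fin 2) (s : Kf i₁ →+* ℂ), s ∈ (Φ₃ m.succ).1 ↔ (e s).2 = decide ((e s).1.val = m.val))
    (b : Bool) (T : Finset ((j : Fin 3) × (Kf (curveSlots i₀ i₁ j) →+* ℂ))) (hT : T.image (toPt' e τ) = pair6 b) :
    weightClassesAlg A₃ ι₃ (2 * 3) T ≤ algebraicClasses (⨁ A₃).X 3 := by
  have hττ : ComplexEmbedding.conjugate τ ≠ τ := CMThreefoldPair.conjugate_ne_of_apply_eq hd hτ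
  have hk : ∀ σ : Kf i₀ →+* ℂ, σ = τ ∨ σ = ComplexEmbedding.conjugate τ := fun σ =>
    DihedralSexticPair.eq_or_eq_conjugate h2 hd hτ σ
  -- every point of `T` is on a threefold slot
  have hTslot : ∀ x ∈ T, ∃ j : Fin 2, x.1 = Fin.succ j := by
    intro x hx
    have hx' : toPt' e τ x ∈ pair6 b := hT ▸ Finset.mem_image_of_mem _ hx
    rcases sigma_cases x with ⟨σ, rfl⟩ | ⟨m, s, rfl⟩
    · rw [toPt'_zero, mem_pair6_iff] at hx'
      obtain ⟨y, hy, -⟩ := hx'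
      exact absurd hy (by simp)
    · exact ⟨m, rfl⟩
  obtain ⟨S'', hS''T, hS''mem⟩ := exists_map_sigma_eq Fin.succ (Fin.succ_injective _) T hTslot
  -- membership and size of `S''`
  have hmemS'' : ∀ y, y ∈ S'' → (e y.2).2 = (if b then decide (y.1 = 0) else !decide (y.1 = 0)) := by
    intro y hy
    have hx' : toPt' e τ ⟨y.1.succ, y.2⟩ ∈ pair6 b := hT ▸ Finset.mem_image_of_mem _ ((hS''mem y).1 hy)
    rw [toPt'_succ, mem_pair6_iff] at hx'
    obtain ⟨w, hw, hw'⟩ := hx'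
    rw [← Sum.inr_injective hw] at hw'
    cases b
    · simp only [Bool.false_eq_true, ↓reduceIte] at hw' ⊢
      exact (weil_structure.2.1 (y.1, e y.2)).1 hw'
    · simp only [↓reduceIte] at hw' ⊢
      exact (weil_structure.1 (y.1, e y.2)).1 hw'
  have hTcard : T.card = 6 := by
    rw [← Finset.card_image_of_injective T (toPt'_injective hττ hk), hT]
    exact (Census.DihedralSexticPairCurve.gens_balanced.2.2 b).2.1
  have hcardS'' : S''.card = 2 * 3 := by rw [← hS''T, Finset.card_map] at hTcard; exact hTcard
  -- the sub-family of the threefold slots IS the pair (definitionally), with its frame data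
  -- the data of the threefold slots, re-typed over the constant field `K = Kf i₁` (definitional)
  let A' : Fin 2 → AbelianVariety ℂ := fun j => A₃ j.succ
  let Φ' : Fin 2 → CMType (Kf i₁) := fun j => Φ₃ j.succ
  let ι' : ∀ j : Fin 2, 𝓞 (Kf i₁) →+* End (A' j) := fun j => ι₃ j.succ
  let θ' : ∀ j : Fin 2, Kf i₁ →+* Module.End ℂ (complexBetti (A' j).X 1) := fun j => θ₃ j.succ
  have hA' : ∀ j : Fin 2, IsCMTypeRealisation (Φ' j) (A' j) (ι' j) (θ' j) := fun j => hA j.succ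
  have hΦ' : ∀ (m : Fin 2) (s : Kf i₁ →+* ℂ), s ∈ (Φ' m).1 ↔ (e s).2 = decide ((e s).1.val = m.val) := hΦ
  have hWeil : weilClassesOf (⨁ A')
      (biproduct.map fun j => ι' j ((![RingOfIntegers.mapRingHom i δ,
        RingOfIntegers.mapRingHom (i.comp (IsCMField.complexConj (Kf i₀)).toRingEquiv.toRingHom) δ] :
          Fin 2 → 𝓞 (Kf i₁)) j)) 3 d ≤ algebraicClasses (⨁ A').X 3 :=
    weilClassesOf_biproduct_le_algebraicClasses_of_frame_of_markman hW4 h6 h2 i hd hδ hτ hA' he_sign hΦ'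
  have halg : weightClassesAlg (K := fun _ => Kf i₁) A' ι' (2 * 3) S'' ≤ algebraicClasses (⨁ A').X 3 := by
    cases b
    · refine (weightClassesAlg_le_weilClassesMinus (K := fun _ => Kf i₁) (A := A') (ι := ι')
        ((![RingOfIntegers.mapRingHom i δ,
          RingOfIntegers.mapRingHom (i.comp (IsCMField.complexConj (Kf i₀)).toRingEquiv.toRingHom) δ] :
            Fin 2 → 𝓞 (Kf i₁))) hcardS'' fun z hz => ?_).trans
        ((weilClassesMinus_le_weilClassesOf _ _ 3 d).trans hWeil)
      exact (apply_weilFamily_eq he_sign h2 hd hτ z).2 (by simpa using hmemS'' z hz)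
    · refine (weightClassesAlg_le_weilClassesPlus (K := fun _ => Kf i₁) (A := A') (ι := ι')
        ((![RingOfIntegers.mapRingHom i δ,
          RingOfIntegers.mapRingHom (i.comp (IsCMField.complexConj (Kf i₀)).toRingEquiv.toRingHom) δ] :
            Fin 2 → 𝓞 (Kf i₁))) hcardS'' fun z hz => ?_).trans
        ((weilClassesPlus_le_weilClassesOf _ _ 3 d).trans hWeil)
      exact (apply_weilFamily_eq he_sign h2 hd hτ z).1 (by simpa using hmemS'' z hz)
  rw [← hS''T]
  exact weightClassesAlg_map_le_algebraicClasses hA Fin.succ (Fin.succ_injective _) hcardS'' halg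

/-! ## §3 The `k`-Weil weights of the fourfolds `Bₘ × E` -/

/-- **The `weil4` lines are algebraic modulo Markman**: a weight `T` of `E × B₀ × B₁` with model image `weil4 m b` lives on
the slots of `Bₘ × E`; its line is the `±i√d`-eigenline of the Weil-type FOURFOLD `(Bₘ ⊞ E, ι_m(iδ) ⊞ ι_E(δ))`
(`k`-signature `(1,2) + (1,0) = (2,2)`), algebraic by Markman's theorem (the tree's
`WeilFourfold.weilClassesOf_le_algebraicClasses_cmThreefold_biprod_cmCurve`), pulled back along the sub-product `(m+1, 0)`.
[cite: Markman2025SurveySecant, Thm. 1.2] [cite: Deligne1982HodgeCycles, §5 (c)] [cite: vanGeemen1994HodgeAV, 4.9] -/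
theorem weightClassesAlg_le_algebraicClasses_of_image_eq_weil4
    (hW4 : Markman2025_weilClasses_algebraic_abelianFourfold)
    (h6 : Module.finrank ℚ (Kf i₁) = 6) (h2 : Module.finrank ℚ (Kf i₀) = 2)
    {δ : 𝓞 (Kf i₀)} {d : ℕ} (hd : 0 < d) (hδ : ((δ : Kf i₀)) ^ 2 = -(d : Kf i₀))
    (hτ : τ (δ : Kf i₀) = Complex.I * (Real.sqrt d : ℂ))
    (hA : ∀ j, IsCMTypeRealisation (Φ₃ j) (A₃ j) (ι₃ j) (θ₃ j))
    (he_sign : ∀ s : Kf i₁ →+* ℂ, s.comp i = τ ↔ (e s).2 = true)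
    (hΨ : ∀ σ : Kf i₀ →+* ℂ, σ ∈ (Φ₃ 0).1 ↔ σ = τ)
    (hΦ : ∀ (m : Fin 2) (s : Kf i₁ →+* ℂ), s ∈ (Φ₃ m.succ).1 ↔ (e s).2 = decide ((e s).1.val = m.val))
    (m : Fin 2) (b : Bool) (T : Finset ((j : Fin 3) × (Kf (curveSlots i₀ i₁ j) →+* ℂ)))
    (hT : T.image (toPt' e τ) = weil4 m b) :
    weightClassesAlg A₃ ι₃ (2 * 2) T ≤ algebraicClasses (⨁ A₃).X 2 := by
  have hττ : ComplexEmbedding.conjugate τ ≠ τ := CMThreefoldPair.conjugate_ne_of_apply_eq hd hτ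
  have hk : ∀ σ : Kf i₀ →+* ℂ, σ = τ ∨ σ = ComplexEmbedding.conjugate τ := fun σ =>
    DihedralSexticPair.eq_or_eq_conjugate h2 hd hτ σ
  have hconjτ : ComplexEmbedding.conjugate τ (δ : Kf i₀) = -(Complex.I * (Real.sqrt d : ℂ)) := by
    rw [ComplexEmbedding.conjugate_coe_eq, hτ, map_mul, Complex.conj_I, Complex.conj_ofReal, neg_mul]
  -- the sub-family `(m+1, 0)` of slots
  let e₄ : Fin 2 → Fin 3 := Fin.cons m.succ fun _ : Fin 1 => 0
  have he₄ : Function.Injective e₄ := by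
    intro p q hpq
    fin_cases p <;> fin_cases q
    · rfl
    · exact absurd hpq (Fin.succ_ne_zero m)
    · exact absurd hpq.symm (Fin.succ_ne_zero m)
    · rfl
  -- every point of `T` is on one of the two slots
  have hTslot : ∀ x ∈ T, ∃ j : Fin 2, x.1 = e₄ j := by
    intro x hx
    have hx' : toPt' e τ x ∈ weil4 m b := hT ▸ Finset.mem_image_of_mem _ hx
    rcases sigma_cases x with ⟨σ, rfl⟩ | ⟨m', s, rfl⟩
    · exact ⟨1, rfl⟩
    · rw [toPt'_succ, mem_weil4_iff] at hx'
      rcases hx' with h | ⟨i', h⟩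
      · exact absurd h (by simp)
      · have hm : m' = m := by
          have h' := Sum.inr_injective h
          simp only [Prod.mk.injEq] at h'
          exact h'.1
        exact ⟨0, by rw [hm]; rfl⟩
  obtain ⟨S'', hS''T, hS''mem⟩ := exists_map_sigma_eq e₄ he₄ T hTslot
  have hTcard : T.card = 4 := by
    rw [← Finset.card_image_of_injective T (toPt'_injective hττ hk), hT]
    exact (Census.DihedralSexticPairCurve.gens_balanced.2.1 m b).2.1
  have hcardS'' : S''.card = 2 * 2 := by rw [← hS''T, Finset.card_map] at hTcard; exact hTcard
  -- the sub-family data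
  let A' : Fin 2 → AbelianVariety ℂ := fun j => A₃ (e₄ j)
  let a' : ∀ j : Fin 2, 𝓞 (Kf (curveSlots i₀ i₁ (e₄ j))) :=
    Fin.cons (RingOfIntegers.mapRingHom i δ) fun _ : Fin 1 => δ
  -- eigenvalues on the points of `S''`
  have hval : ∀ z ∈ S'', z.2 ((a' z.1 : 𝓞 (Kf (curveSlots i₀ i₁ (e₄ z.1)))) : Kf (curveSlots i₀ i₁ (e₄ z.1))) =
      if b then Complex.I * (Real.sqrt d : ℂ) else -(Complex.I * (Real.sqrt d : ℂ)) := by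
    intro z hz
    have hx' : toPt' e τ ⟨e₄ z.1, z.2⟩ ∈ weil4 m b := hT ▸ Finset.mem_image_of_mem _ ((hS''mem z).1 hz)
    obtain ⟨z1, z2⟩ := z
    refine Fin.cases ?_ (fun p => ?_) z1 z2 hx'
    · -- threefold slot `m+1`: sign `b`
      intro s hs
      change toPt' e τ ⟨m.succ, s⟩ ∈ weil4 m b at hs
      rw [toPt'_succ, mem_weil4_iff] at hs
      rcases hs with h | ⟨i', h⟩
      · exact absurd h (by simp)
      · have hsign : (e s).2 = b := by
          have h' := Sum.inr_injective h
          simp only [Prod.mk.injEq] at h'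
          rw [h'.2]
        show (s.comp i) (δ : Kf i₀) = _
        cases b
        · have h1 : s.comp i = ComplexEmbedding.conjugate τ := comp_eq_conjugate_of_sign_false he_sign h2 hd hτ hsign
          rw [h1]
          exact hconjτ
        · have h1 : s.comp i = τ := (he_sign s).2 hsign
          rw [h1]
          exact hτ
    · -- the curve slot `0`: the embedding of sign `b`
      intro σ hσ
      have hp : p = 0 := Subsingleton.elim p 0
      subst hp
      change toPt' e τ ⟨0, σ⟩ ∈ weil4 m b at hσ
      rw [toPt'_zero, mem_weil4_iff] at hσ
      rcases hσ with h | ⟨i', h⟩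
      · have hσb : decide (σ = τ) = b := Sum.inl_injective h
        show σ (δ : Kf i₀) = _
        cases b
        · have hσ' : σ = ComplexEmbedding.conjugate τ :=
            (hk σ).resolve_left (of_decide_eq_false hσb)
          rw [hσ']
          exact hconjτ
        · rw [of_decide_eq_true hσb]
          exact hτ
      · exact absurd h (by simp)
  -- the Weil plane of the fourfold `A₃ (m+1) ⊞ A₃ 0`, algebraic by Markman
  let ΦB : CMType (Kf i₁) := Φ₃ m.succ
  let ιB : 𝓞 (Kf i₁) →+* End (A₃ m.succ) := ι₃ m.succ
  let θB : Kf i₁ →+* Module.End ℂ (complexBetti (A₃ m.succ).X 1) := θ₃ m.succ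
  have hB : IsCMTypeRealisation ΦB (A₃ m.succ) ιB θB := hA m.succ
  let ΦE : CMType (Kf i₀) := Φ₃ 0
  let ιE : 𝓞 (Kf i₀) →+* End (A₃ 0) := ι₃ 0
  let θE : Kf i₀ →+* Module.End ℂ (complexBetti (A₃ 0).X 1) := θ₃ 0
  have hE : IsCMTypeRealisation ΦE (A₃ 0) ιE θE := hA 0
  have hΨE : ∀ σ : Kf i₀ →+* ℂ, σ ∈ ΦE.1 ↔ σ = τ := hΨ
  have hΦB : ∀ s : Kf i₁ →+* ℂ, s ∈ ΦB.1 ↔ (e s).2 = decide ((e s).1.val = m.val) := hΦ m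
  have hcount : ∀ τ' : Kf i₀ →+* ℂ,
      (Finset.univ.filter fun s : Kf i₁ →+* ℂ => s.comp i = τ' ∧ s ∈ ΦB.1).card +
        (if τ' ∈ ΦE.1 then 1 else 0) = 2 := by
    intro τ'
    rcases hk τ' with h' | h' <;> rw [h']
    · rw [if_pos ((hΨE τ).2 rfl)]
      have hfilter : (Finset.univ.filter fun s : Kf i₁ →+* ℂ => s.comp i = τ ∧ s ∈ ΦB.1) =
          Finset.univ.filter fun s => e s ∈
            (Finset.univ.filter fun y : ZMod 3 × Bool => y.2 = true ∧ y.1.val = m.val) := by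
        refine Finset.filter_congr fun s _ => ?_
        rw [he_sign, hΦB s, Finset.mem_filter]
        constructor
        · rintro ⟨h1, h2⟩; rw [h1] at h2; exact ⟨Finset.mem_univ _, h1, of_decide_eq_true h2.symm⟩
        · rintro ⟨-, h1, h2⟩; exact ⟨h1, by rw [h1, decide_eq_true h2]⟩
      rw [hfilter, card_filter_equiv_mem]
      fin_cases m <;> decide
    · have hnot : ComplexEmbedding.conjugate τ ∉ ΦE.1 := fun h => hττ ((hΨE _).1 h)
      rw [if_neg hnot, add_zero]
      have hfilter : (Finset.univ.filter fun s : Kf i₁ →+* ℂ =>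
          s.comp i = ComplexEmbedding.conjugate τ ∧ s ∈ ΦB.1) =
          Finset.univ.filter fun s => e s ∈
            (Finset.univ.filter fun y : ZMod 3 × Bool => y.2 = false ∧ ¬ y.1.val = m.val) := by
        refine Finset.filter_congr fun s _ => ?_
        rw [hΦB s, Finset.mem_filter]
        constructor
        · rintro ⟨h1, h2⟩
          have hs : (e s).2 = false := by
            by_contra h3
            rw [Bool.not_eq_false, ← he_sign] at h3
            exact hττ (h1 ▸ h3 ▸ rfl)
          rw [hs] at h2
          exact ⟨Finset.mem_univ _, hs, fun h4 => by rw [decide_eq_true h4] at h2; exact Bool.false_ne_true h2⟩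
        · rintro ⟨-, h1, h3⟩
          refine ⟨comp_eq_conjugate_of_sign_false he_sign h2 hd hτ h1, ?_⟩
          rw [h1, decide_eq_false h3]
      rw [hfilter, card_filter_equiv_mem]
      fin_cases m <;> decide
  have hWeil4 : weilClassesOf (A₃ m.succ ⊞ A₃ 0)
      (biprod.map (ιB (RingOfIntegers.mapRingHom i δ)) (ιE δ)) 2 d ≤ algebraicClasses (A₃ m.succ ⊞ A₃ 0).X 2 :=
    WeilFourfold.weilClassesOf_le_algebraicClasses_cmThreefold_biprod_cmCurve hW4 h6 h2 i hB hE hd hδ hcount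
  have hWeil : weilClassesOf (⨁ A') (biproduct.map fun j => ι₃ (e₄ j) (a' j)) 2 d ≤ algebraicClasses (⨁ A').X 2 :=
    weilClassesOf_biproduct_le_algebraicClasses_of_biprod (A := A') (fun j => ι₃ (e₄ j) (a' j)) hWeil4
  have halg : weightClassesAlg (K := fun j => Kf (curveSlots i₀ i₁ (e₄ j))) A' (fun j => ι₃ (e₄ j)) (2 * 2) S'' ≤
      algebraicClasses (⨁ A').X 2 := by
    cases b
    · refine (weightClassesAlg_le_weilClassesMinus (K := fun j => Kf (curveSlots i₀ i₁ (e₄ j))) (A := A')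
        (ι := fun j => ι₃ (e₄ j)) a' hcardS'' fun z hz => ?_).trans
        ((weilClassesMinus_le_weilClassesOf _ _ 2 d).trans hWeil)
      simpa using hval z hz
    · refine (weightClassesAlg_le_weilClassesPlus (K := fun j => Kf (curveSlots i₀ i₁ (e₄ j))) (A := A')
        (ι := fun j => ι₃ (e₄ j)) a' hcardS'' fun z hz => ?_).trans
        ((weilClassesPlus_le_weilClassesOf _ _ 2 d).trans hWeil)
      simpa using hval z hz
  rw [← hS''T]
  exact weightClassesAlg_map_le_algebraicClasses hA e₄ he₄ hcardS'' halg

end Generators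

end Summit.HodgeConjecture.CorCM.DihedralSexticPairCurve

end
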